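import Literature.MathematicalPhysics.QuantumFieldTheory.Balaban1983to89.B1Eq324BenfattoClassSectEMemberPrecisionDoorRowsByName

/-!
# `Balaban1983to89.B1Eq324BenfattoClassSectEMemberPrecisionDoorIneq2153AtOne` — THE `γ₀` ROW OF THE `U = 1` PRECISION DOOR TRANSFERRED TO [4] (2.153):
# p. 428's *"C\*Δ_kC with a lower bound γ₀ > 0 … We have proved it in [4], Lemma 2.4, for operators with U = 1"* as a theorem about NODE 00's letters —
# the coercivity of `η^{d+1}C\*Δ_kC(1)` on the variables `Λ̃` FOLLOWS from (2.153) on print's constrained subspace through the parametrisation `B = CB̃`;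
# p679063 §3b re-keyed: (3.24) at the trivial background MODULO [4] (2.153) AT NODE 00's LETTERS ALONE; and the door of record p680757 §6 with its `γ₀` row
# in print's shape — a lower bound for `η^{d+1}Δ_k(U)` on the `V`-constrained subspace of (3.156), transferred at general `U` through the pivot units of the regime
# (seat dag-n08-b gen 35, CLAIM-15; node N08 [Balaban1985UV3], row `h324c`)

statement-level companion of published sources with citation tags; every declaration here is a theorem; nothing here is a claim about the
Yang–Mills mass gap

THE PRINTED LOCUS.  [Balaban1985BackgroundPropagators] (= [B9]) Sect. E p. 428 (held `paper:balaban1985-cmp99-background-propagators`, PDF 40, re-read this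
session): *"⟨B,(QG₁Q\*)⁻¹B⟩ − a⟨B,B⟩ − 2⟨H₁D̃⁽²⁾(B),J⟩ = ⟨B,Δ_kB⟩. (3.156)  This form is considered on the subspace {B : B = 0 on Λᶜ, B = 0 on ⋃_{y∈Λ′} Ax(y),
Q₁B = 0}. We can parametrize this subspace in the same way as in [4] (2.154)–(2.155), using part of the variables B, which we denote by B̃. These are variables B
restricted to the set of bonds Λ̃ = Λ ∖ (⋃_{y∈Λ′} Ax(y) ∪ ⋃_{c∈Λ′} (B(c) ∩ c)). … Variables B depend linearly on B̃ and we have B = CB̃ … (C\*Δ_kC)⁻¹ = C̃^{(k)}(Λ) …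
(3.158) … It is more convenient to work with the operator C̃^{(k)}(Λ), because it is defined by a positive definite operator C\*Δ_kC with a lower bound γ₀ > 0
independent of k and U. We have proved it in [4], Lemma 2.4, for operators with U = 1."*  [Balaban1984PropagatorsII] (= [4]) p. 249: *"Using (2.118) and (2.128)
we get ⟨B, Δ_kB⟩ ≥ (γ₀∕12d²)L^{−d−1}‖B‖², or Δ_k ≥ (γ₀∕12d²)L^{−d−1} (2.153) on the subspace of B satisfying: QB = 0, B(Γ_{y,x}) = 0 for x ∈ B(y)"*, applied
*"on the whole lattice T^{(k)}, or on a subset Λ ⊂ T^{(k)}"* (same page; quotation as carried verbatim by `B6LowerBound2153Torus`).  [Balaban1985UV3] (24) p. 262 and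
pp. 271–272 (row `h324c` of node N08); [Balaban1982Higgs1] (3.24) p. 616; [BenfattoEtAl1978] Lemma (4.5)–(4.7) p. 152.

WHY THIS MODULE (cell `pub-ymgap`, seat `dag-n08-b` gen 35, CLAIM-15).  The `U = 1` edition of the citable (3.24) precision door, p679063 §3b
`…PrecisionDoorRowsByName.eq324_CsDeltaCPY_opsYOfRecordV8E_trBasis_one_of_coercive_on_unit`, holds for every class member above a threshold MODULO ONE displayed
row: the coercivity `γ₀` (R5′) of the COMPOSITE print-unit precision letter `CsDeltaCPY … 1 = η^{d+1}C\*Δ_kC(1) = C\*·(η^{d+1}Δ_k(1))·C` (def-Y `CsDeltaCPY_eq`) on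
`Λ̃`-frames — an operator assembled from five letters (`elimCtΛY`, `QG1Qinv`, `aY`, `D2J`, `elimCΛY`), about which print says exactly one thing: it follows from
[4] Lemma 2.4 at `U = 1`, i.e. from (2.153) for `Δ_k` on the constrained subspace.  This file TYPES THAT SENTENCE at NODE 00's letters: the `γ₀` row of the
composite follows from the (2.153)-shaped lower bound for def-Y's `η^{d+1}Δ_k(1) = deltaKPY … 1` (`= η^{d+1}(QG₁Q\*)⁻¹(1) − η^{d+1}a`, `deltaKPY_one`) on print's
subspace «`B = 0` off `Λ`, `B = 0` on the axial trees, `(Q₁B)(c) = 0`, `c ∈ Λ′`», by the parametrisation `B = C(1)Φ`: the constraints hold on the range of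
`C(1)` unconditionally (def-Y `Q1Y_elimCY_one`, `elimCY_apply_of_isAxialY`, `elimCY_apply_of_not_inΛY`), `C(1)` is the identity on `Λ̃`
(`elimCY_apply_of_lamTY`, so `‖C(1)Φ‖ ≥ ‖Φ‖`), and `C(1)* ` is the transpose of `C(1)` for the real trace pairing (p671624 `sum_trReForm_elimCΛY_ofRecordTC_one`).
So the door's last displayed row becomes the PRINTED inequality [4] (2.153) read at NODE 00's letters — the statement node N06 ∕ cell `pub-balaban` type
((2.118) for the nested-domain `(QG₁Q\*)⁻¹(1) = (onFun EE)♯`, Lemma 2.4 (2.128); on the `Tor M ∕ formDk` carrier they are `B6Lemma24Torus.lemma24_torus`,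
`B6LowerBound2153Torus.lowerBound2153_lattice`) — instead of a coercivity clause about a five-letter composite.

WHAT IS PROVED (sorry-free, 0 `def`, standard axioms; pairing = the weight-one real trace pairing `trIP 1` of n06-j, `Σ_u Re tr(Φ(u)ᴴΨ(u))`).
* §1 private `trIP_one_self_le_of_eq_or_zero` ([folklore] `‖Φ‖² ≤ ‖B‖²` when `Φ(s) ∈ {0, B(s)}` pointwise); ★★ `coercive_CsDeltaCPY_one_of_ineq2153` — at a member `x`, ANY
  covariance letters `𝔏`, the seven-letter Sect. E record `sectELettersYOfRecordTC x (avYOfRecord x) 𝔢₀`, `U = 1`: (2.153)-shape for `deltaKPY … 1` on print's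
  subspace (`¬ inΛY x q → B q = 0`, `IsAxialY x q → B q = 0`, `Q1Y x (avYOfRecord x) 1 c.1 B = 0`) with constant `γ ≥ 0` ⇒ `γ·trIP 1 Φ Φ ≤ trIP 1 Φ (CsDeltaCPY … 1 Φ)`
  for every `Φ` supported in `Λ̃`; ★ `…_frame` (support off the range of a `Λ̃`-valued index — the door's literal row); ★★ `coercive_CsDeltaCPY_of_ineq2153_of_units`
  — the same transfer at a GENERAL background `U` for an averaged field `V = 𝔳 U` with unitary values and unit pivot coefficients `K_c(V)`, `K_c(V)*` (the
  `V`-constrained subspace: `Q1Y x 𝔳 U c.1 B = 0`), and ★★ `…_of_smallVY` (def-Y's small-field regime `SmallVY x 𝔳 G U δ`, `G ≤ U(N)`: no `IsUnit` hypotheses) —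
  print's parametrisation is background-independent algebra, the lower bound it moves (G-B9-09 at `U ≠ 1`) is node N06's and NOT claimed;
  ★ `coercive_CsDeltaCPY_sectEYOfRecordV6_one_of_ineq2153` (at def-Y's v6 letters of record `sectEYOfRecordV6 N θ M⋆ 𝔢₀ x`, `U = 1`, the shape the v6∕v8 instances read).
* §2 ★★★ `eq324_CsDeltaCPY_opsYOfRecordV8E_trBasis_one_of_ineq2153_on_unit` — p679063 §3b VERBATIM with the `γ₀` row REPLACED by [4] (2.153) at the v8 instance's
  letters (`lettersYOfRecordV4 … (resYOfC2 𝔠) x`, `sectEYOfRecordV6 … (sectEYWithDt2 … 𝔡₂ 𝔢₀) x`), one `γ₀ > 0` for all members (print: «independent of k»):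
  (3.24) for `𝒩(0, 𝕄_ι(CsDeltaCPY 1)⁻¹)` above the member threshold `M₆`, `4 ≤ ℓ`, `2 ≤ d + 1`, MODULO [4] (2.153) AT NODE 00's LETTERS ALONE.
* §3 ★★★ `eq324_CsDeltaCPY_opsYOfRecordV8E_trBasis_of_stmt3132Printed_R_of_adjCurrent_of_ineq2153_onΛ_on_unit` — THE DOOR OF RECORD p680757 §6 (class-parametric
  family form at `bg9YR SU(N) R₁ R₂`) VERBATIM with its `γ₀` row (R5′) REPLACED by the Δ_k-row in print's own shape, (3.156) *"considered on the subspace {B : B = 0 on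
  Λᶜ, B = 0 on ⋃ Ax(y), Q₁B = 0}"* with *"a lower bound γ₀ > 0 independent of k and U"*: `γ₀·trIP 1 B B ≤ trIP 1 B (deltaKPY … U B)` on the `V`-constrained subspace
  (`V = avYOfRecord x U`); the transfer's pivot-unit ∕ unitarity inputs are theorems in the door's regime (`mem_of_reg335R`, `avYOfRecord_mem`, def-Y
  `isUnit_KY_KTY_avYOfRecord_of_plaqSmall` from the displayed `hP` and `hsmall`).

HONEST SCOPE.  Count-neutral; consumer-side algebra (compositions BY NAME of def-Y's `C ∕ C\*` faces and print-unit letters, p671624's transposes, p679063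
§3b); the door re-key is at `U = 1` only, the transfer itself also at general `U` modulo the pivot units ∕ in the small-field regime; `γ₀` (G-B9-09) is NOT proved and NOT claimed — what is proved is print's implication «[4] (2.153) on the constrained subspace ⇒ the
lower bound of `C\*Δ_kC`» at `U = 1`; (2.153) itself ((2.118) + Lemma 2.4 on NODE 00's carrier `domT ∕ IBondY`) stays DISPLAYED, node N06 ∕ `pub-balaban` content;
nothing at `U ≠ 1` (there print's route is «localizing the operators in Δ_k and using the methods of Sect. B», not taken); NORM ∕ PAIRING DICTIONARY: `trIP 1` is
print's `⟨·,·⟩` up to the flat `η^{−(d+1)}` convention, which def-Y's `deltaKPY ∕ CsDeltaCPY` carry on the operator side (both sides of each inequality scale alike);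
the IDENT for row `h324c` (NODE 00's pin `(𝔖 k).μ = 𝒩(0, 𝕄_Λ̃(η^{d+1}C\*Δ_kC)⁻¹).map Φ`, box, class-II letters, window `b₁ < b₀`) is NOT made, NOT commissioned, NOT
claimed; nothing of [Balaban1985UV3], [Balaban1985BackgroundPropagators], [Balaban1984PropagatorsII], [Balaban1982Higgs1] or [BenfattoEtAl1978] is asserted beyond
what the tree proves; node N08 is NOT discharged; nothing about d = 4, the continuum, OS axioms, a mass gap or the Clay problem.
-/

noncomputable section

open MeasureTheory Finset Matrix

namespace Literature.MathematicalPhysics.QuantumFieldTheory.Balaban1983to89.B1Eq324BenfattoClassSectEMemberPrecisionDoorIneq2153AtOne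

open Literature.MathematicalPhysics.QuantumFieldTheory
open Literature.MathematicalPhysics.QuantumFieldTheory.Balaban1983to89.B1Eq324BenfattoLemma
open Literature.MathematicalPhysics.QuantumFieldTheory.Balaban1983to89.B9PinMembersKLevelV1 (MemberY)
open Literature.MathematicalPhysics.QuantumFieldTheory.Balaban1983to89.B9PinGeometryKLevelV1 (unitDistY inΛY)
open Literature.MathematicalPhysics.QuantumFieldTheory.Balaban1983to89.Node00

/-! ## §1 The transfer: [4] (2.153) on print's constrained subspace ⇒ the `γ₀` row of `η^{d+1}C*Δ_kC(1)` on `Λ̃`-supported functions -/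

section Transfer

open scoped Matrix.Norms.L2Operator
open B9Thm311ReadingCoords (trIP)
open B9CoReadingCoordsTranspose (trReForm trReForm_symm sum_trReForm_eq_trIP)
open B1Eq324BenfattoClassSectEMemberRealAdjointAtNode00 (sum_trReForm_elimCΛY_ofRecordTC sum_trReForm_elimCΛY_ofRecordTC_one)

variable {N : ℕ} {d ℓ : ℕ} {hd : 1 ≤ d + 1} {hL : Odd (ℓ + 1) ∧ 1 < ℓ + 1} {b₀ b₁ : ℝ} {Mstar : ℕ}

/-- one summand of the weight-one trace pairing of `Φ` with itself is `Σ_{a,b} ‖Φ(s)_{ab}‖²`, hence monotone under «`Φ(s) = 0` or `Φ(s) = B(s)`». [folklore] -/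
private theorem trIP_one_self_le_of_eq_or_zero {S : Type} [Fintype S] (Φ B : S → Matrix (Fin N) (Fin N) ℂ) (h : ∀ s, Φ s = 0 ∨ Φ s = B s) :
    trIP (fun _ => (1 : ℝ)) Φ Φ ≤ trIP (fun _ => (1 : ℝ)) B B := by
  unfold trIP
  refine Finset.sum_le_sum fun s _ => ?_
  rw [one_mul, one_mul]
  rcases h s with h0 | hB
  · rw [h0]
    simp only [Matrix.zero_apply, star_zero, zero_mul, Complex.zero_re, Finset.sum_const_zero]
    exact Finset.sum_nonneg fun a _ => Finset.sum_nonneg fun b _ => by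
      rw [Complex.star_def, ← Complex.normSq_eq_conj_mul_self, Complex.ofReal_re]; exact Complex.normSq_nonneg _
  · rw [hB]

variable (x : MemberY d ℓ hd hL b₀ b₁ Mstar)

/-- ★★ **THE `γ₀` ROW OF `η^{d+1}C*Δ_kC(1)` FROM [4] (2.153) ON PRINT's CONSTRAINED SUBSPACE** (the transfer behind p. 428's *"a positive definite operator
C\*Δ_kC with a lower bound γ₀ > 0 independent of k and U. We have proved it in [4], Lemma 2.4, for operators with U = 1"*).  At a member `x`, any covariance
letters `𝔏`, the Sect. E letters of record `sectELettersYOfRecordTC x (avYOfRecord x) 𝔢₀` (def-Y: their `P_Λ C P_Λ̃ ∕ P_Λ̃ C* P_Λ` ARE `C(V) ∕ C(V)*`) and the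
trivial background `U = 1`: IF print's `η^{d+1}Δ_k(1)` (def-Y `deltaKPY … 1 = η^{d+1}(QG₁Q*)⁻¹(1) − η^{d+1}a`) satisfies `γ‖B‖² ≤ ⟨B, η^{d+1}Δ_k(1)B⟩` for every `B`
in the subspace *"B = 0 on Λᶜ, B = 0 on ⋃_{y∈Λ′} Ax(y), Q₁B = 0"* of (3.156) — [4] (2.153) p. 249 *"Δ_k ≥ (γ₀∕12d²)L^{−d−1} on the subspace of B satisfying: QB = 0,
B(Γ_{y,x}) = 0 for x ∈ B(y)"*, *"on the whole lattice T^{(k)}, or on a subset Λ ⊂ T^{(k)}"* — THEN `γ‖Φ‖² ≤ ⟨Φ, η^{d+1}C*Δ_kC(1)Φ⟩` for every `Φ` supported in the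
variables `Λ̃`.  Proof = print's parametrisation `B = CB̃`: `⟨Φ, C*(η^{d+1}Δ_k)CΦ⟩ = ⟨CΦ, η^{d+1}Δ_k CΦ⟩` (def-Y `CsDeltaCPY_eq`, the `U = 1` transpose
`sum_trReForm_elimCΛY_ofRecordTC_one`); `B := C(1)Φ` lies in the subspace (def-Y `elimCY_apply_of_not_inΛY`, `elimCY_apply_of_isAxialY`, `Q1Y_elimCY_one` — at
`U = 1` the constraints hold on the range of `C` unconditionally); `‖B‖² ≥ ‖Φ‖²` since `C` is the identity on `Λ̃` (`elimCY_apply_of_lamTY`).  The pairing is the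
weight-one real trace pairing `trIP 1` (print's `⟨·,·⟩` up to the flat convention carried by `deltaKPY ∕ CsDeltaCPY`).
[cite: Balaban1985BackgroundPropagators, (3.156)–(3.158) p.428; Balaban1984PropagatorsII, (2.153) p.249, (2.154)–(2.156) pp.249–250, Lemma 2.4 (2.128) p.245] -/
theorem coercive_CsDeltaCPY_one_of_ineq2153 (𝔏 : CovLettersY (Matrix (Fin N) (Fin N) ℂ) x)
    (𝔢₀ : SectELettersY (Matrix (Fin N) (Fin N) ℂ) x) {γ : ℝ} (hγ : 0 ≤ γ)
    (h2153 : ∀ B : IBondY x.toKIdx → Matrix (Fin N) (Fin N) ℂ,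
      (∀ q, ¬ inΛY x q → B q = 0) → (∀ q, IsAxialY x q → B q = 0) →
      (∀ c : CBondY x, Q1Y x (avYOfRecord x) (fun _ _ => 1 : CfgY (Matrix (Fin N) (Fin N) ℂ) x.toKIdx) c.1 B = 0) →
        γ * trIP (fun _ => (1 : ℝ)) B B ≤
          trIP (fun _ => (1 : ℝ)) B (deltaKPY x 𝔏 (sectELettersYOfRecordTC x (avYOfRecord x) 𝔢₀) (fun _ _ => 1) B))
    (Φ : IBondY x.toKIdx → Matrix (Fin N) (Fin N) ℂ) (hΦ : ∀ q, ¬ lamTY x q → Φ q = 0) :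
    γ * trIP (fun _ => (1 : ℝ)) Φ Φ ≤
      trIP (fun _ => (1 : ℝ)) Φ (CsDeltaCPY x 𝔏 (sectELettersYOfRecordTC x (avYOfRecord x) 𝔢₀) (fun _ _ => 1) Φ) := by
  set B : IBondY x.toKIdx → Matrix (Fin N) (Fin N) ℂ :=
    elimCY x (avYOfRecord x) (fun _ _ => 1 : CfgY (Matrix (Fin N) (Fin N) ℂ) x.toKIdx) Φ with hB
  have hC : elimCΛY x (sectELettersYOfRecordTC x (avYOfRecord x) 𝔢₀)
      (fun _ _ => 1 : CfgY (Matrix (Fin N) (Fin N) ℂ) x.toKIdx) Φ = B := by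
    rw [elimCΛY_sectELettersYOfRecordTC]
  have hform : trIP (fun _ => (1 : ℝ)) Φ
        (CsDeltaCPY x 𝔏 (sectELettersYOfRecordTC x (avYOfRecord x) 𝔢₀) (fun _ _ => 1) Φ) =
      trIP (fun _ => (1 : ℝ)) B (deltaKPY x 𝔏 (sectELettersYOfRecordTC x (avYOfRecord x) 𝔢₀) (fun _ _ => 1) B) := by
    rw [CsDeltaCPY_eq, Module.End.mul_apply, Module.End.mul_apply, hC, ← sum_trReForm_eq_trIP, ← sum_trReForm_eq_trIP]
    have ht := sum_trReForm_elimCΛY_ofRecordTC_one x 𝔢₀ Φ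
      (deltaKPY x 𝔏 (sectELettersYOfRecordTC x (avYOfRecord x) 𝔢₀) (fun _ _ => 1) B)
    simp only [LinearMap.restrictScalars_apply] at ht
    rw [hC] at ht
    calc ∑ u, trReForm (Φ u) (elimCtΛY x (sectELettersYOfRecordTC x (avYOfRecord x) 𝔢₀) (fun _ _ => 1)
              (deltaKPY x 𝔏 (sectELettersYOfRecordTC x (avYOfRecord x) 𝔢₀) (fun _ _ => 1) B) u)
        = ∑ u, trReForm (elimCtΛY x (sectELettersYOfRecordTC x (avYOfRecord x) 𝔢₀) (fun _ _ => 1)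
              (deltaKPY x 𝔏 (sectELettersYOfRecordTC x (avYOfRecord x) 𝔢₀) (fun _ _ => 1) B) u) (Φ u) :=
          Finset.sum_congr rfl fun u _ => trReForm_symm _ _
      _ = ∑ u, trReForm (deltaKPY x 𝔏 (sectELettersYOfRecordTC x (avYOfRecord x) 𝔢₀) (fun _ _ => 1) B u) (B u) := ht.symm
      _ = ∑ u, trReForm (B u) (deltaKPY x 𝔏 (sectELettersYOfRecordTC x (avYOfRecord x) 𝔢₀) (fun _ _ => 1) B u) :=
          Finset.sum_congr rfl fun u _ => trReForm_symm _ _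
  rw [hform]
  have hBD : ∀ q, ¬ inΛY x q → B q = 0 := fun q hq => elimCY_apply_of_not_inΛY x (avYOfRecord x) _ Φ hq
  have hBA : ∀ q, IsAxialY x q → B q = 0 := fun q hq => elimCY_apply_of_isAxialY x (avYOfRecord x) _ Φ hq
  have hBQ : ∀ c : CBondY x,
      Q1Y x (avYOfRecord x) (fun _ _ => 1 : CfgY (Matrix (Fin N) (Fin N) ℂ) x.toKIdx) c.1 B = 0 :=
    fun c => Q1Y_elimCY_one x c Φ
  have hle : trIP (fun _ => (1 : ℝ)) Φ Φ ≤ trIP (fun _ => (1 : ℝ)) B B :=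
    trIP_one_self_le_of_eq_or_zero Φ B fun q => by
      by_cases hq : lamTY x q
      · exact Or.inr (elimCY_apply_of_lamTY x (avYOfRecord x) _ Φ hq).symm
      · exact Or.inl (hΦ q hq)
  exact (mul_le_mul_of_nonneg_left hle hγ).trans (h2153 B hBD hBA hBQ)

/-- ★ **THE SAME TRANSFER FOR A `Λ̃`-FRAME SUPPORT** — the literal shape of the door's `γ₀` row (p679063 §3b): `Φ` vanishing off the range of a `Λ̃`-valued index
`ι`. [cite: Balaban1985BackgroundPropagators, (3.156)–(3.158) p.428; Balaban1984PropagatorsII, (2.153) p.249] -/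
theorem coercive_CsDeltaCPY_one_of_ineq2153_frame (𝔏 : CovLettersY (Matrix (Fin N) (Fin N) ℂ) x)
    (𝔢₀ : SectELettersY (Matrix (Fin N) (Fin N) ℂ) x) {γ : ℝ} (hγ : 0 ≤ γ)
    (h2153 : ∀ B : IBondY x.toKIdx → Matrix (Fin N) (Fin N) ℂ,
      (∀ q, ¬ inΛY x q → B q = 0) → (∀ q, IsAxialY x q → B q = 0) →
      (∀ c : CBondY x, Q1Y x (avYOfRecord x) (fun _ _ => 1 : CfgY (Matrix (Fin N) (Fin N) ℂ) x.toKIdx) c.1 B = 0) →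
        γ * trIP (fun _ => (1 : ℝ)) B B ≤
          trIP (fun _ => (1 : ℝ)) B (deltaKPY x 𝔏 (sectELettersYOfRecordTC x (avYOfRecord x) 𝔢₀) (fun _ _ => 1) B))
    {σ : Type} (ι : σ → IBondY x.toKIdx) (hιT : ∀ s, lamTY x (ι s))
    (Φ : IBondY x.toKIdx → Matrix (Fin N) (Fin N) ℂ) (hΦ : ∀ u, u ∉ Set.range ι → Φ u = 0) :
    γ * trIP (fun _ => (1 : ℝ)) Φ Φ ≤
      trIP (fun _ => (1 : ℝ)) Φ (CsDeltaCPY x 𝔏 (sectELettersYOfRecordTC x (avYOfRecord x) 𝔢₀) (fun _ _ => 1) Φ) :=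
  coercive_CsDeltaCPY_one_of_ineq2153 x 𝔏 𝔢₀ hγ h2153 Φ fun q hq => hΦ q fun hq' => hq (by obtain ⟨s, rfl⟩ := hq'; exact hιT s)

variable (𝔳 : AvY (Matrix (Fin N) (Fin N) ℂ) x)

/-- ★★ **THE SAME TRANSFER AT A GENERAL BACKGROUND, MODULO THE PIVOT UNITS** — print's parametrisation is background-independent algebra: for an averaged field
`V = 𝔳 U` with unitary values whose pivot coefficients `K_c(V)` and their transposes are units (so that the constraints `(Q(V)C(V)B)(c) = 0` hold on the range of
`C(V)`, def-Y `Q1Y_elimCY`, and `C(V)*` is the trace-transpose of `C(V)`, p671624 `sum_trReForm_elimCΛY_ofRecordTC`), a lower bound `γ` for def-Y's print-unit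
`η^{d+1}Δ_k(U) = deltaKPY … U` (`= η^{d+1}(QG₁Q*)⁻¹(U) − η^{d+1}a − η^{d+1}⟨D̃⁽²⁾·, J⟩(U)`, (3.156)) on the `V`-constrained subspace «`B = 0` off `Λ`, `B = 0` on the
axial trees, `(Q(V)B)(c) = 0`, `c ∈ Λ′`» IS a lower bound `γ` for `η^{d+1}C(V)*Δ_k(U)C(V)` on the `Λ̃`-supported functions.  (Print, p. 428, continues: *"Localizing the
operators in Δ_k and using the methods of Sect. B we can prove it for C\*Δ_kC with an arbitrary configuration U satisfying (3.35), (3.36) with Mα₀ sufficiently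
small"* — that lower bound is node N06's G-B9-09 and is NOT claimed; this theorem only moves it between the two operators.)
[cite: Balaban1985BackgroundPropagators, (3.156)–(3.158) p.428, (3.9) p.392; Balaban1984PropagatorsII, (2.153)–(2.156) pp.249–250] -/
theorem coercive_CsDeltaCPY_of_ineq2153_of_units (𝔏 : CovLettersY (Matrix (Fin N) (Fin N) ℂ) x)
    (𝔢₀ : SectELettersY (Matrix (Fin N) (Fin N) ℂ) x) {U : CfgY (Matrix (Fin N) (Fin N) ℂ) x.toKIdx}
    (h𝔳 : ∀ b : UBondY x, ((𝔳 U b : (Matrix (Fin N) (Fin N) ℂ)ˣ) : Matrix (Fin N) (Fin N) ℂ) ∈ unitary (Matrix (Fin N) (Fin N) ℂ))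
    (hK : ∀ c : CBondY x, IsUnit (KY x 𝔳 U c)) (hKT : ∀ c : CBondY x, IsUnit (KTY x 𝔳 U c)) {γ : ℝ} (hγ : 0 ≤ γ)
    (h2153 : ∀ B : IBondY x.toKIdx → Matrix (Fin N) (Fin N) ℂ,
      (∀ q, ¬ inΛY x q → B q = 0) → (∀ q, IsAxialY x q → B q = 0) → (∀ c : CBondY x, Q1Y x 𝔳 U c.1 B = 0) →
        γ * trIP (fun _ => (1 : ℝ)) B B ≤ trIP (fun _ => (1 : ℝ)) B (deltaKPY x 𝔏 (sectELettersYOfRecordTC x 𝔳 𝔢₀) U B))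
    (Φ : IBondY x.toKIdx → Matrix (Fin N) (Fin N) ℂ) (hΦ : ∀ q, ¬ lamTY x q → Φ q = 0) :
    γ * trIP (fun _ => (1 : ℝ)) Φ Φ ≤ trIP (fun _ => (1 : ℝ)) Φ (CsDeltaCPY x 𝔏 (sectELettersYOfRecordTC x 𝔳 𝔢₀) U Φ) := by
  set B : IBondY x.toKIdx → Matrix (Fin N) (Fin N) ℂ := elimCY x 𝔳 U Φ
  have hC : elimCΛY x (sectELettersYOfRecordTC x 𝔳 𝔢₀) U Φ = B := by rw [elimCΛY_sectELettersYOfRecordTC]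
  have hform : trIP (fun _ => (1 : ℝ)) Φ (CsDeltaCPY x 𝔏 (sectELettersYOfRecordTC x 𝔳 𝔢₀) U Φ) =
      trIP (fun _ => (1 : ℝ)) B (deltaKPY x 𝔏 (sectELettersYOfRecordTC x 𝔳 𝔢₀) U B) := by
    rw [CsDeltaCPY_eq, Module.End.mul_apply, Module.End.mul_apply, hC, ← sum_trReForm_eq_trIP, ← sum_trReForm_eq_trIP]
    have ht := sum_trReForm_elimCΛY_ofRecordTC x 𝔳 𝔢₀ h𝔳 hK hKT Φ (deltaKPY x 𝔏 (sectELettersYOfRecordTC x 𝔳 𝔢₀) U B)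
    simp only [LinearMap.restrictScalars_apply] at ht
    rw [hC] at ht
    calc ∑ u, trReForm (Φ u) (elimCtΛY x (sectELettersYOfRecordTC x 𝔳 𝔢₀) U (deltaKPY x 𝔏 (sectELettersYOfRecordTC x 𝔳 𝔢₀) U B) u)
        = ∑ u, trReForm (elimCtΛY x (sectELettersYOfRecordTC x 𝔳 𝔢₀) U (deltaKPY x 𝔏 (sectELettersYOfRecordTC x 𝔳 𝔢₀) U B) u) (Φ u) :=
          Finset.sum_congr rfl fun u _ => trReForm_symm _ _
      _ = ∑ u, trReForm (deltaKPY x 𝔏 (sectELettersYOfRecordTC x 𝔳 𝔢₀) U B u) (B u) := ht.symm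
      _ = ∑ u, trReForm (B u) (deltaKPY x 𝔏 (sectELettersYOfRecordTC x 𝔳 𝔢₀) U B u) :=
          Finset.sum_congr rfl fun u _ => trReForm_symm _ _
  rw [hform]
  have hBD : ∀ q, ¬ inΛY x q → B q = 0 := fun q hq => elimCY_apply_of_not_inΛY x 𝔳 U Φ hq
  have hBA : ∀ q, IsAxialY x q → B q = 0 := fun q hq => elimCY_apply_of_isAxialY x 𝔳 U Φ hq
  have hBQ : ∀ c : CBondY x, Q1Y x 𝔳 U c.1 B = 0 := fun c => Q1Y_elimCY x 𝔳 U (hK c) Φ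
  have hle : trIP (fun _ => (1 : ℝ)) Φ Φ ≤ trIP (fun _ => (1 : ℝ)) B B :=
    trIP_one_self_le_of_eq_or_zero Φ B fun q => by
      by_cases hq : lamTY x q
      · exact Or.inr (elimCY_apply_of_lamTY x 𝔳 U Φ hq).symm
      · exact Or.inl (hΦ q hq)
  exact (mul_le_mul_of_nonneg_left hle hγ).trans (h2153 B hBD hBA hBQ)

/-- ★★ **THE TRANSFER IN def-Y's SMALL-FIELD REGIME — NO `IsUnit` HYPOTHESES** (`SmallVY x 𝔳 G U δ`, `G ≤ U(N)`: def-Y `isUnit_KY_of_smallVY ∕ isUnit_KTY_of_smallVY`).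
[cite: Balaban1985BackgroundPropagators, (3.156)–(3.158) p.428, (3.35) p.396; Balaban1984PropagatorsII, (2.153)–(2.156) pp.249–250] -/
theorem coercive_CsDeltaCPY_of_ineq2153_of_smallVY (𝔏 : CovLettersY (Matrix (Fin N) (Fin N) ℂ) x)
    (𝔢₀ : SectELettersY (Matrix (Fin N) (Fin N) ℂ) x) {G : Subgroup (Matrix (Fin N) (Fin N) ℂ)ˣ}
    (hG : G ≤ B7Prop2Explicit.unitaryUnits (Matrix (Fin N) (Fin N) ℂ)) {U : CfgY (Matrix (Fin N) (Fin N) ℂ) x.toKIdx} {δ : ℝ} (hs : SmallVY x 𝔳 G U δ)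
    {γ : ℝ} (hγ : 0 ≤ γ)
    (h2153 : ∀ B : IBondY x.toKIdx → Matrix (Fin N) (Fin N) ℂ,
      (∀ q, ¬ inΛY x q → B q = 0) → (∀ q, IsAxialY x q → B q = 0) → (∀ c : CBondY x, Q1Y x 𝔳 U c.1 B = 0) →
        γ * trIP (fun _ => (1 : ℝ)) B B ≤ trIP (fun _ => (1 : ℝ)) B (deltaKPY x 𝔏 (sectELettersYOfRecordTC x 𝔳 𝔢₀) U B))
    (Φ : IBondY x.toKIdx → Matrix (Fin N) (Fin N) ℂ) (hΦ : ∀ q, ¬ lamTY x q → Φ q = 0) :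
    γ * trIP (fun _ => (1 : ℝ)) Φ Φ ≤ trIP (fun _ => (1 : ℝ)) Φ (CsDeltaCPY x 𝔏 (sectELettersYOfRecordTC x 𝔳 𝔢₀) U Φ) :=
  coercive_CsDeltaCPY_of_ineq2153_of_units x 𝔳 𝔏 𝔢₀ (fun b => B7Prop2Explicit.mem_unitaryUnits.mp (hG (hs.2.1 b)))
    (isUnit_KY_of_smallVY x 𝔳 hs) (isUnit_KTY_of_smallVY x 𝔳 hs) hγ h2153 Φ hΦ

variable (N) (θ : Stage3Params) (Mstar' : ℕ) (𝔢₁ : SectEY N θ Mstar')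

/-- ★ **THE TRANSFER AT THE v6 SECT. E LETTERS OF RECORD** (def-Y `sectEYOfRecordV6`, member by member the seven-letter record over `avYOfRecord`), `U = 1`, for any
covariance letters `𝔏` — the shape every v6∕v8 instance of NODE 00 reads (`sectEYOfRecordV6_apply`, `rfl`).
[cite: Balaban1985BackgroundPropagators, (3.156)–(3.158) p.428; Balaban1984PropagatorsII, (2.153) p.249] -/
theorem coercive_CsDeltaCPY_sectEYOfRecordV6_one_of_ineq2153 (x : MemberY θ.d₆ θ.ℓ₆ θ.hd' θ.hL' θ.b₀ θ.b₁ Mstar')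
    (𝔏 : CovLettersY (Matrix (Fin N) (Fin N) ℂ) x) {γ : ℝ} (hγ : 0 ≤ γ)
    (h2153 : ∀ B : IBondY x.toKIdx → Matrix (Fin N) (Fin N) ℂ,
      (∀ q, ¬ inΛY x q → B q = 0) → (∀ q, IsAxialY x q → B q = 0) →
      (∀ c : CBondY x, Q1Y x (avYOfRecord x) (fun _ _ => 1 : CfgY (Matrix (Fin N) (Fin N) ℂ) x.toKIdx) c.1 B = 0) →
        γ * trIP (fun _ => (1 : ℝ)) B B ≤
          trIP (fun _ => (1 : ℝ)) B (deltaKPY x 𝔏 (sectEYOfRecordV6 N θ Mstar' 𝔢₁ x) (fun _ _ => 1) B))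
    {σ : Type} (ι : σ → IBondY x.toKIdx) (hιT : ∀ s, lamTY x (ι s))
    (Φ : IBondY x.toKIdx → Matrix (Fin N) (Fin N) ℂ) (hΦ : ∀ u, u ∉ Set.range ι → Φ u = 0) :
    γ * trIP (fun _ => (1 : ℝ)) Φ Φ ≤
      trIP (fun _ => (1 : ℝ)) Φ (CsDeltaCPY x 𝔏 (sectEYOfRecordV6 N θ Mstar' 𝔢₁ x) (fun _ _ => 1) Φ) :=
  coercive_CsDeltaCPY_one_of_ineq2153_frame x 𝔏 (𝔢₁ x) hγ h2153 ι hιT Φ hΦ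

end Transfer

/-! ## §2 The `U = 1` door MODULO [4] (2.153) AT NODE 00's LETTERS ALONE -/

section Door

open scoped Matrix.Norms.L2Operator
open B9Thm311ReadingCoords (trIP)
open B9CoReadingCoordsTranspose (trReForm TrIdx trBasis)
open B9PinMembersKLevelV1 (geo9Y)
open B1Eq324BenfattoClassSectEMemberPrecisionDoorRowsByName (eq324_CsDeltaCPY_opsYOfRecordV8E_trBasis_one_of_coercive_on_unit)

variable {d : ℕ}

/-- ★★★ **THE (3.24) PRECISION DOOR AT `U = 1` MODULO [4] (2.153) AT NODE 00's LETTERS ALONE** — p679063 §3b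
`eq324_CsDeltaCPY_opsYOfRecordV8E_trBasis_one_of_coercive_on_unit` («(3.24) at the trivial background modulo `γ₀` alone») with its last displayed row, the
coercivity `γ₀` (R5′) of the COMPOSITE print-unit precision `CsDeltaCPY … 1 = η^{d+1}C*Δ_kC(1)` on `Λ̃`-frames (G-B9-09 at `U = 1`), REPLACED by the inequality
print cites for it, p. 428 *"We have proved it in [4], Lemma 2.4, for operators with U = 1"*: [4] (2.153) p. 249 *"⟨B, Δ_kB⟩ ≥ (γ₀∕12d²)L^{−d−1}‖B‖² … on the subspace
of B satisfying: QB = 0, B(Γ_{y,x}) = 0 for x ∈ B(y)"* (*"on the whole lattice T^{(k)}, or on a subset Λ ⊂ T^{(k)}"*) — here, at every member above the threshold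
`M₆`, for def-Y's print-unit `η^{d+1}Δ_k(1) = deltaKPY … 1` at the v8 instance's letters (`lettersYOfRecordV4 … (resYOfC2 𝔠) x`,
`sectEYOfRecordV6 … (sectEYWithDt2 … 𝔡₂ 𝔢₀) x`) on print's subspace «`B = 0` off `Λ` (`inΛY`), `B = 0` on the axial trees (`IsAxialY`), `(Q₁(1)B)(c) = 0` at
every `c ∈ Λ′` (`Q1Y … c.1`)», with one constant `γ₀ > 0` for all members (print: *"independent of k"*).  The transfer is §1
`coercive_CsDeltaCPY_one_of_ineq2153` (`Φ` supported in `range ι ⊂ Λ̃`).  HYPOTHESES LEFT: scalars, `2 ≤ d + 1`, `4 ≤ ℓ`, the member threshold `M₆ ≤ M`, an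
injective `Λ̃`-valued frame index `ι`, and [4] (2.153) at NODE 00's letters.  Conclusion: (3.24) for `𝒩(0, 𝕄_ι(CsDeltaCPY 1)⁻¹)` verbatim as in §3b.  WHAT
(2.153) IS, there: (2.118) `γ₀‖∂₁B‖² ≤ ⟨B, Δ_kB⟩` for the nested-domain `(QG₁Q*)⁻¹(1) = (onFun EE)♯` of NODE 00 minus `η^{d+1}a`, and Lemma 2.4 (2.128) on NODE 00's
carrier — node N06 ∕ `pub-balaban` content (on the `Tor M ∕ formDk` carrier: `B6Lemma24Torus.lemma24_torus`, `B6LowerBound2153Torus.lowerBound2153_lattice`),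
NOT typed here.
[cite: Balaban1985BackgroundPropagators, (3.156)–(3.158) p.428, (3.132) p.422, Cor. 3.5 p.407; Balaban1984PropagatorsII, (2.153) p.249, Lemma 2.4 (2.128) p.245,
(2.118) p.243, Prop. 2.7 (2.149) p.249; Balaban1985UV3, (24) p.262, pp.271–272; Balaban1982Higgs1, (3.24) p.616; BenfattoEtAl1978, Lemma (4.5)–(4.7) p.152
(class form; bent window, presentation and coordinates ours)] -/
theorem eq324_CsDeltaCPY_opsYOfRecordV8E_trBasis_one_of_ineq2153_on_unit (N : ℕ) [NeZero N] (θ : Stage3Params) (hD : 2 ≤ θ.d₆ + 1) (hℓ : 4 ≤ θ.ℓ₆)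
    (Mstar : ℕ) (𝔠 : C2Y N θ Mstar) (𝔡₂ : Dt2Y N θ Mstar) (𝔢₀ : SectEY N θ Mstar) {γ₀ : ℝ} (hγ₀ : 0 < γ₀)
    (t D : ℕ) {ϰ : ℝ} (hϰ : 0 < ϰ)
    {p₀ σ' c κ' : ℝ} (hp₀ : 2 / 3 < p₀) (hσ : 0 < σ') (hc : 0 ≤ c) (hκ : 0 < κ') (hκσ : κ' < σ' * (t + 1)) :
    ∃ M₆ b₁ : ℝ, ∀ b₀ : ℝ, b₁ < b₀ → ∃ C : ℝ, 0 ≤ C ∧ ∀ η : ℝ, 0 < η → η ≤ 1 →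
      ∀ (x : MemberY θ.d₆ θ.ℓ₆ θ.hd' θ.hL' θ.b₀ θ.b₁ Mstar) [DecidableEq (IBondY x.toKIdx)], M₆ ≤ (geo9Y x).M →
      ∀ {σ : Type} [Fintype σ] [DecidableEq σ] [Nonempty σ] (ι : σ → IBondY x.toKIdx), Function.Injective ι → (∀ s, lamTY x (ι s)) →
        (∀ B : IBondY x.toKIdx → Matrix (Fin N) (Fin N) ℂ, (∀ q, ¬ inΛY x q → B q = 0) → (∀ q, IsAxialY x q → B q = 0) →
          (∀ c : CBondY x, Q1Y x (avYOfRecord x) (fun _ _ => 1 : CfgY (Matrix (Fin N) (Fin N) ℂ) x.toKIdx) c.1 B = 0) →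
          γ₀ * trIP (fun _ => (1 : ℝ)) B B ≤ trIP (fun _ => (1 : ℝ)) B ((deltaKPY x (lettersYOfRecordV4 N θ Mstar (resYOfC2 N θ Mstar 𝔠) x)
            (sectEYOfRecordV6 N θ Mstar (sectEYWithDt2 N θ Mstar (resYOfC2 N θ Mstar 𝔠) 𝔡₂ 𝔢₀) x) (fun _ _ => 1)) B)) →
      ∃ (Λ : Finset (B1Eq324BenfattoLemma.Site (θ.d₆ + 1 + (θ.d₆ + 1) + 1))) (e' : σ × TrIdx N ≃ ↥Λ),
        ((gaussianFieldOfKernel fun u w => if h : u ∈ Λ ∧ w ∈ Λ then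
            ((Matrix.reindex e' e'
              (Matrix.of fun p q : σ × TrIdx N =>
                  trReForm (trBasis N p.2) (((CsDeltaCPY x (lettersYOfRecordV4 N θ Mstar (resYOfC2 N θ Mstar 𝔠) x)
            (sectEYOfRecordV6 N θ Mstar (sectEYWithDt2 N θ Mstar (resYOfC2 N θ Mstar 𝔠) 𝔡₂ 𝔢₀) x) (fun _ _ => 1)).restrictScalars ℝ)
                    (Pi.single (ι q.1) (trBasis N q.2)) (ι p.1))))⁻¹ :
                Matrix ↥Λ ↥Λ ℝ) ⟨u, h.1⟩ ⟨w, h.2⟩ else 0).map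
            (fun (z : B1Eq324BenfattoLemma.Site (θ.d₆ + 1 + (θ.d₆ + 1) + 1) → ℝ) (q : σ × TrIdx N) => z ((e' q : ↥Λ) : B1Eq324BenfattoLemma.Site (θ.d₆ + 1 + (θ.d₆ + 1) + 1))) =
          gaussianFieldOfKernel fun p q =>
            ((Matrix.of fun p q : σ × TrIdx N =>
                trReForm (trBasis N p.2) (((CsDeltaCPY x (lettersYOfRecordV4 N θ Mstar (resYOfC2 N θ Mstar 𝔠) x)
            (sectEYOfRecordV6 N θ Mstar (sectEYWithDt2 N θ Mstar (resYOfC2 N θ Mstar 𝔠) 𝔡₂ 𝔢₀) x) (fun _ _ => 1)).restrictScalars ℝ)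
                  (Pi.single (ι q.1) (trBasis N q.2)) (ι p.1)))⁻¹ :
              Matrix (σ × TrIdx N) (σ × TrIdx N) ℝ) p q) ∧
        (∀ p : ℝ, 0 ≤ p →
          ((fun (z : B1Eq324BenfattoLemma.Site (θ.d₆ + 1 + (θ.d₆ + 1) + 1) → ℝ) (q : σ × TrIdx N) => z ((e' q : ↥Λ) : B1Eq324BenfattoLemma.Site (θ.d₆ + 1 + (θ.d₆ + 1) + 1))) ⁻¹'
              {ω : σ × TrIdx N → ℝ | ∀ q, |ω q| ≤ p}) =ᵐ[gaussianFieldOfKernel fun u w => if h : u ∈ Λ ∧ w ∈ Λ then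
                ((Matrix.reindex e' e'
                  (Matrix.of fun p q : σ × TrIdx N =>
                      trReForm (trBasis N p.2) (((CsDeltaCPY x (lettersYOfRecordV4 N θ Mstar (resYOfC2 N θ Mstar 𝔠) x)
            (sectEYOfRecordV6 N θ Mstar (sectEYWithDt2 N θ Mstar (resYOfC2 N θ Mstar 𝔠) 𝔡₂ 𝔢₀) x) (fun _ _ => 1)).restrictScalars ℝ)
                        (Pi.single (ι q.1) (trBasis N q.2)) (ι p.1))))⁻¹ :
                    Matrix ↥Λ ↥Λ ℝ) ⟨u, h.1⟩ ⟨w, h.2⟩ else 0]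
            smallFieldSet Λ p) ∧
        ∀ (s : ℕ) (I J : Finset (B1Eq324BenfattoLemma.Site (θ.d₆ + 1 + (θ.d₆ + 1) + 1))) (𝔞 : Coef (θ.d₆ + 1 + (θ.d₆ + 1) + 1)),
          I.Nonempty → J ⊆ I → J ⊆ Λ → coefSup s D 𝔞 J ≤ c * η ^ σ' →
          0 < ∫ z, cutoffBoltzmann (hamiltonian s D ϰ 𝔞 J) I (B10.pFun b₀ p₀ η) z ∂(gaussianFieldOfKernel fun u w => if h : u ∈ Λ ∧ w ∈ Λ then
              ((Matrix.reindex e' e'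
                (Matrix.of fun p q : σ × TrIdx N =>
                    trReForm (trBasis N p.2) (((CsDeltaCPY x (lettersYOfRecordV4 N θ Mstar (resYOfC2 N θ Mstar 𝔠) x)
            (sectEYOfRecordV6 N θ Mstar (sectEYWithDt2 N θ Mstar (resYOfC2 N θ Mstar 𝔠) 𝔡₂ 𝔢₀) x) (fun _ _ => 1)).restrictScalars ℝ)
                      (Pi.single (ι q.1) (trBasis N q.2)) (ι p.1))))⁻¹ :
                  Matrix ↥Λ ↥Λ ℝ) ⟨u, h.1⟩ ⟨w, h.2⟩ else 0) ∧
            |Real.log (∫ z, cutoffBoltzmann (hamiltonian s D ϰ 𝔞 J) I (B10.pFun b₀ p₀ η) z ∂(gaussianFieldOfKernel fun u w =>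
                if h : u ∈ Λ ∧ w ∈ Λ then
                  ((Matrix.reindex e' e'
                    (Matrix.of fun p q : σ × TrIdx N =>
                        trReForm (trBasis N p.2) (((CsDeltaCPY x (lettersYOfRecordV4 N θ Mstar (resYOfC2 N θ Mstar 𝔠) x)
            (sectEYOfRecordV6 N θ Mstar (sectEYWithDt2 N θ Mstar (resYOfC2 N θ Mstar 𝔠) 𝔡₂ 𝔢₀) x) (fun _ _ => 1)).restrictScalars ℝ)
                          (Pi.single (ι q.1) (trBasis N q.2)) (ι p.1))))⁻¹ :
                      Matrix ↥Λ ↥Λ ℝ) ⟨u, h.1⟩ ⟨w, h.2⟩ else 0)) -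
              cumulantSum (gaussianFieldOfKernel fun u w => if h : u ∈ Λ ∧ w ∈ Λ then
                  ((Matrix.reindex e' e'
                    (Matrix.of fun p q : σ × TrIdx N =>
                        trReForm (trBasis N p.2) (((CsDeltaCPY x (lettersYOfRecordV4 N θ Mstar (resYOfC2 N θ Mstar 𝔠) x)
            (sectEYOfRecordV6 N θ Mstar (sectEYWithDt2 N θ Mstar (resYOfC2 N θ Mstar 𝔠) 𝔡₂ 𝔢₀) x) (fun _ _ => 1)).restrictScalars ℝ)
                          (Pi.single (ι q.1) (trBasis N q.2)) (ι p.1))))⁻¹ :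
                      Matrix ↥Λ ↥Λ ℝ) ⟨u, h.1⟩ ⟨w, h.2⟩ else 0)
                (hamiltonian s D ϰ 𝔞 J) t| ≤ C * η ^ κ' * I.card := by
  obtain ⟨M₆, b₁, H⟩ := eq324_CsDeltaCPY_opsYOfRecordV8E_trBasis_one_of_coercive_on_unit N θ hD hℓ Mstar 𝔠 𝔡₂ 𝔢₀ hγ₀ t D hϰ hp₀ hσ hc hκ hκσ
  refine ⟨M₆, b₁, fun b₀ hb₀ => ?_⟩
  obtain ⟨C, hC, hE⟩ := H b₀ hb₀
  refine ⟨C, hC, ?_⟩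
  intro η hη hηle x _ hMx σ _ _ _ ι hι hιT h2153
  exact hE η hη hηle x hMx ι hι hιT fun Φ hΦ =>
    coercive_CsDeltaCPY_one_of_ineq2153 x (lettersYOfRecordV4 N θ Mstar (resYOfC2 N θ Mstar 𝔠) x)
      (sectEYWithDt2 N θ Mstar (resYOfC2 N θ Mstar 𝔠) 𝔡₂ 𝔢₀ x) hγ₀.le h2153 Φ
      fun q hq => hΦ q fun hq' => hq (by obtain ⟨s, rfl⟩ := hq'; exact hιT s)

end Door

/-! ## §3 The door of record (p680757 §6, class-parametric family form) with its `γ₀` row REPLACED by the Δ_k-row on print's `V`-constrained subspace -/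

section DoorOfRecord

open scoped Matrix.Norms.L2Operator
open B7Prop2Explicit (unitaryUnits)
open B7Prop2SpecialUnitary (specialUnitaryUnits specialUnitaryUnits_le_unitaryUnits)
open B9Thm311ReadingCoords (trIP)
open B9CoReadingCoordsTranspose (trReForm TrIdx trBasis)
open B8Lemma1NonAbelian (pairTop)
open B9PinMembersKLevelV1 (geo9Y bg9Y)
open B9Eq3132NuReading (siteKernelOfOpNu nuY opsYNuOfRecordV4E)
open B9BackgroundsKLevelV1R (RegFamY bg9YR MemOfFam siteKernelR mem_of_reg335R)
open B1Eq324BenfattoClassSectEMemberPrecisionDoorRowsByName (eq324_CsDeltaCPY_opsYOfRecordV8E_trBasis_of_stmt3132Printed_R_of_adjCurrent_onΛ_on_unit)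

variable {d : ℕ}

/-- ★★★ **THE DOOR OF RECORD WITH ITS `γ₀` ROW IN PRINT's SHAPE** — p680757 §6 `…_of_stmt3132Printed_R_of_adjCurrent_onΛ_on_unit` (the class-parametric family form at
def-Y's carrier `bg9YR SU(N) R₁ R₂`; hypothesis = n06-i's edition-8 row-26 face type) VERBATIM with the last displayed row (R5′) — the coercivity `γ₀` of the COMPOSITE
`CsDeltaCPY … U = η^{d+1}C(V)\*Δ_k(U)C(V)` on `Λ̃`-frames — REPLACED by the row print states for the operator it is assembled from, (3.156) p. 428 *"⟨B, Δ_kB⟩ … This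
form is considered on the subspace {B : B = 0 on Λᶜ, B = 0 on ⋃_{y∈Λ′} Ax(y), Q₁B = 0}"* with *"a lower bound γ₀ > 0 independent of k and U"*: for every `B` with `B = 0`
off `Λ`, `B = 0` on the axial trees and `(Q(V)B)(c) = 0` at every `c ∈ Λ′` (`V = avYOfRecord x U`, the averaged field of record), `γ₀·trIP 1 B B ≤ trIP 1 B (deltaKPY … U B)`
(def-Y's print-unit `η^{d+1}Δ_k(U) = η^{d+1}(QG₁Q\*)⁻¹(U) − η^{d+1}a − η^{d+1}⟨D̃⁽²⁾·, J⟩(U)` at the v8 instance's letters).  The transfer is §1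
`coercive_CsDeltaCPY_of_ineq2153_of_units`; its pivot-unit and unitarity inputs are theorems in the door's own regime (`U` is `SU(N)`-valued by `mem_of_reg335R hR`,
`avYOfRecord_mem`, def-Y `isUnit_KY_KTY_avYOfRecord_of_plaqSmall` from the displayed plaquette smallness `hP` and print's small-curvature numeral `hsmall`).  Every other row
and the conclusion ((3.24) for `𝒩(0, 𝕄_ι(CsDeltaCPY U)⁻¹)`) VERBATIM as in p680757 §6; the Δ_k-row is node N06's G-B9-09 in print's own currency, DISPLAYED, NOT claimed.
[cite: Balaban1985BackgroundPropagators, (3.156)–(3.158) p.428, (3.132) p.422, (3.136) p.422, Thm 3.12 p.423, (3.35)–(3.36) p.396, p.427, (3.117) p.419; Balaban1985Averaging,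
(136) p.39; Balaban1984PropagatorsII, (2.149) p.249, (2.153) p.249; Balaban1985UV3, (24) p.262, pp.271–272; Balaban1982Higgs1, (3.24) p.616; BenfattoEtAl1978, Lemma (4.5)–(4.7)
p.152 (class form; bent window, presentation and coordinates ours)] -/
theorem eq324_CsDeltaCPY_opsYOfRecordV8E_trBasis_of_stmt3132Printed_R_of_adjCurrent_of_ineq2153_onΛ_on_unit (N : ℕ) [NeZero N] (θ : Stage3Params) (hD : 2 ≤ θ.d₆ + 1)
    (Mstar : ℕ) (𝔠 : C2Y N θ Mstar) (𝔡₂ : Dt2Y N θ Mstar) (𝔢₀ 𝔢 : SectEY N θ Mstar) (𝔴 : RWEY N θ Mstar) (𝔈 : ExpsY N θ Mstar)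
    (R₁ R₂ : RegFamY θ.d₆ θ.ℓ₆ θ.hd' θ.hL' θ.b₀ θ.b₁ Mstar (Matrix (Fin N) (Fin N) ℂ)) (hR : MemOfFam (specialUnitaryUnits (Fin N)) R₁) {c35 : ℝ}
    (h26 : B9.Stmt3132Printed (θ.d₆ + 1) c35
      (geo9Y (d := θ.d₆) (ℓ := θ.ℓ₆) (hd := θ.hd') (hL := θ.hL') (b₀ := θ.b₀) (b₁ := θ.b₁) (Mstar := Mstar))
      (bg9YR (Matrix (Fin N) (Fin N) ℂ) (specialUnitaryUnits (Fin N)) R₁ R₂)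
      (fun x => siteKernelR R₁ R₂ (opsYNuOfRecordV4E N θ Mstar (resYOfC2 N θ Mstar 𝔠) 𝔢 𝔴 𝔈 x).QGQinv)
      (fun x => siteKernelR R₁ R₂ (opsYNuOfRecordV4E N θ Mstar (resYOfC2 N θ Mstar 𝔠) 𝔢 𝔴 𝔈 x).QG1Qinv))
    {γ₀ a j₁ C₂ r₂ : ℝ} (hγ₀ : 0 < γ₀) (ha : 0 ≤ a) (hj₁ : 0 ≤ j₁) (hC₂ : 0 ≤ C₂) (hsmall : (((θ.ℓ₆ + 1 : ℕ) : ℝ)) ^ (θ.d₆ + 1) *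
      (2 * ((((θ.d₆ * (2 * θ.ℓ₆ + 1) : ℕ) : ℝ)) * a) * (((θ.ℓ₆ + 1 : ℕ) + (θ.d₆ + 1) * θ.ℓ₆ : ℕ) : ℝ)) < 1)
    (t D : ℕ) {ϰ : ℝ} (hϰ : 0 < ϰ)
    {p₀ σ' c κ' : ℝ} (hp₀ : 2 / 3 < p₀) (hσ : 0 < σ') (hc : 0 ≤ c) (hκ : 0 < κ') (hκσ : κ' < σ' * (t + 1)) :
    ∃ M₄ δ a₀ : ℝ, 0 < M₄ ∧ 0 < δ ∧ 0 < a₀ ∧ ∃ b₁ : ℝ, ∀ b₀ : ℝ, b₁ < b₀ → ∃ C : ℝ, 0 ≤ C ∧ ∀ η : ℝ, 0 < η → η ≤ 1 →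
      ∀ (x : MemberY θ.d₆ θ.ℓ₆ θ.hd' θ.hL' θ.b₀ θ.b₁ Mstar) [DecidableEq (IBondY x.toKIdx)], M₄ ≤ (geo9Y x).M →
      ∀ α₀ : ℝ, 0 < α₀ → (geo9Y x).M * α₀ ≤ a₀ →
      ∀ (U : CfgY (Matrix (Fin N) (Fin N) ℂ) x.toKIdx), R₁ x c35 α₀ U → R₂ x c35 α₀ U →
        (∀ c' : CBondY x, B8Lemma1NonAbelian.PlaqSmall (VzY x (avYOfRecord x U)) (labK x c'.1.1) (labK x c'.1.1 + pairTop (θ.ℓ₆ + 1) c'.1.2) a) →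
        (∀ A A' : FBondY x.toKIdx → Matrix (Fin N) (Fin N) ℂ, (𝔠 x).form U (star A) (star A') = star ((𝔠 x).form U A A')) →
        (∀ B B' : IBondY x.toKIdx → Matrix (Fin N) (Fin N) ℂ, (𝔡₂ x).form U (star B) (star B') = star ((𝔡₂ x).form U B B')) →
      ∀ {σ : Type} [Fintype σ] [DecidableEq σ] [Nonempty σ] (ι : σ → IBondY x.toKIdx), Function.Injective ι → (∀ s, lamTY x (ι s)) →
      ∀ (S : IBondY x.toKIdx → Prop),
        (∀ z, S z → etaDY x * ‖trAdjY (trDualMatY N) ((lettersYOfRecordV4 N θ Mstar (resYOfC2 N θ Mstar 𝔠) x).H₁ U) (JY x.toKIdx U) z‖ ≤ j₁) →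
        (∀ (u v : IBondY x.toKIdx) (E a : Matrix (Fin N) (Fin N) ℂ) (z : IBondY x.toKIdx), inΛY x u → inΛY x v →
          (𝔡₂ x).form U (Pi.single v E) (Pi.single u a) z ≠ 0 → S z) →
        (∀ (u v : IBondY x.toKIdx) (E a : Matrix (Fin N) (Fin N) ℂ), r₂ < unitDistY x u v → (𝔡₂ x).form U (Pi.single v E) (Pi.single u a) = 0) →
        (∀ (u v : IBondY x.toKIdx) (E a : Matrix (Fin N) (Fin N) ℂ), ∑ z, ‖(𝔡₂ x).form U (Pi.single v E) (Pi.single u a) z‖ ≤ C₂ * ‖E‖ * ‖a‖) →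
        (∀ B : IBondY x.toKIdx → Matrix (Fin N) (Fin N) ℂ, (∀ q, ¬ inΛY x q → B q = 0) → (∀ q, IsAxialY x q → B q = 0) →
          (∀ c' : CBondY x, Q1Y x (avYOfRecord x) U c'.1 B = 0) →
          γ₀ * trIP (fun _ => (1 : ℝ)) B B ≤ trIP (fun _ => (1 : ℝ)) B ((deltaKPY x (lettersYOfRecordV4 N θ Mstar (resYOfC2 N θ Mstar 𝔠) x)
            (sectEYOfRecordV6 N θ Mstar (sectEYWithDt2 N θ Mstar (resYOfC2 N θ Mstar 𝔠) 𝔡₂ 𝔢₀) x) U) B)) →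
      ∃ (Λ : Finset (B1Eq324BenfattoLemma.Site (θ.d₆ + 1 + (θ.d₆ + 1) + 1))) (e' : σ × TrIdx N ≃ ↥Λ),
        ((gaussianFieldOfKernel fun u w => if h : u ∈ Λ ∧ w ∈ Λ then
            ((Matrix.reindex e' e'
              (Matrix.of fun p q : σ × TrIdx N =>
                  trReForm (trBasis N p.2) (((CsDeltaCPY x (lettersYOfRecordV4 N θ Mstar (resYOfC2 N θ Mstar 𝔠) x)
            (sectEYOfRecordV6 N θ Mstar (sectEYWithDt2 N θ Mstar (resYOfC2 N θ Mstar 𝔠) 𝔡₂ 𝔢₀) x) U).restrictScalars ℝ)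
                    (Pi.single (ι q.1) (trBasis N q.2)) (ι p.1))))⁻¹ :
                Matrix ↥Λ ↥Λ ℝ) ⟨u, h.1⟩ ⟨w, h.2⟩ else 0).map
            (fun (z : B1Eq324BenfattoLemma.Site (θ.d₆ + 1 + (θ.d₆ + 1) + 1) → ℝ) (q : σ × TrIdx N) => z ((e' q : ↥Λ) : B1Eq324BenfattoLemma.Site (θ.d₆ + 1 + (θ.d₆ + 1) + 1))) =
          gaussianFieldOfKernel fun p q =>
            ((Matrix.of fun p q : σ × TrIdx N =>
                trReForm (trBasis N p.2) (((CsDeltaCPY x (lettersYOfRecordV4 N θ Mstar (resYOfC2 N θ Mstar 𝔠) x)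
            (sectEYOfRecordV6 N θ Mstar (sectEYWithDt2 N θ Mstar (resYOfC2 N θ Mstar 𝔠) 𝔡₂ 𝔢₀) x) U).restrictScalars ℝ)
                  (Pi.single (ι q.1) (trBasis N q.2)) (ι p.1)))⁻¹ :
              Matrix (σ × TrIdx N) (σ × TrIdx N) ℝ) p q) ∧
        (∀ p : ℝ, 0 ≤ p →
          ((fun (z : B1Eq324BenfattoLemma.Site (θ.d₆ + 1 + (θ.d₆ + 1) + 1) → ℝ) (q : σ × TrIdx N) => z ((e' q : ↥Λ) : B1Eq324BenfattoLemma.Site (θ.d₆ + 1 + (θ.d₆ + 1) + 1))) ⁻¹'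
              {ω : σ × TrIdx N → ℝ | ∀ q, |ω q| ≤ p}) =ᵐ[gaussianFieldOfKernel fun u w => if h : u ∈ Λ ∧ w ∈ Λ then
                ((Matrix.reindex e' e'
                  (Matrix.of fun p q : σ × TrIdx N =>
                      trReForm (trBasis N p.2) (((CsDeltaCPY x (lettersYOfRecordV4 N θ Mstar (resYOfC2 N θ Mstar 𝔠) x)
            (sectEYOfRecordV6 N θ Mstar (sectEYWithDt2 N θ Mstar (resYOfC2 N θ Mstar 𝔠) 𝔡₂ 𝔢₀) x) U).restrictScalars ℝ)
                        (Pi.single (ι q.1) (trBasis N q.2)) (ι p.1))))⁻¹ :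
                    Matrix ↥Λ ↥Λ ℝ) ⟨u, h.1⟩ ⟨w, h.2⟩ else 0]
            smallFieldSet Λ p) ∧
        ∀ (s : ℕ) (I J : Finset (B1Eq324BenfattoLemma.Site (θ.d₆ + 1 + (θ.d₆ + 1) + 1))) (𝔞 : Coef (θ.d₆ + 1 + (θ.d₆ + 1) + 1)),
          I.Nonempty → J ⊆ I → J ⊆ Λ → coefSup s D 𝔞 J ≤ c * η ^ σ' →
          0 < ∫ z, cutoffBoltzmann (hamiltonian s D ϰ 𝔞 J) I (B10.pFun b₀ p₀ η) z ∂(gaussianFieldOfKernel fun u w => if h : u ∈ Λ ∧ w ∈ Λ then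
              ((Matrix.reindex e' e'
                (Matrix.of fun p q : σ × TrIdx N =>
                    trReForm (trBasis N p.2) (((CsDeltaCPY x (lettersYOfRecordV4 N θ Mstar (resYOfC2 N θ Mstar 𝔠) x)
            (sectEYOfRecordV6 N θ Mstar (sectEYWithDt2 N θ Mstar (resYOfC2 N θ Mstar 𝔠) 𝔡₂ 𝔢₀) x) U).restrictScalars ℝ)
                      (Pi.single (ι q.1) (trBasis N q.2)) (ι p.1))))⁻¹ :
                  Matrix ↥Λ ↥Λ ℝ) ⟨u, h.1⟩ ⟨w, h.2⟩ else 0) ∧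
            |Real.log (∫ z, cutoffBoltzmann (hamiltonian s D ϰ 𝔞 J) I (B10.pFun b₀ p₀ η) z ∂(gaussianFieldOfKernel fun u w =>
                if h : u ∈ Λ ∧ w ∈ Λ then
                  ((Matrix.reindex e' e'
                    (Matrix.of fun p q : σ × TrIdx N =>
                        trReForm (trBasis N p.2) (((CsDeltaCPY x (lettersYOfRecordV4 N θ Mstar (resYOfC2 N θ Mstar 𝔠) x)
            (sectEYOfRecordV6 N θ Mstar (sectEYWithDt2 N θ Mstar (resYOfC2 N θ Mstar 𝔠) 𝔡₂ 𝔢₀) x) U).restrictScalars ℝ)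
                          (Pi.single (ι q.1) (trBasis N q.2)) (ι p.1))))⁻¹ :
                      Matrix ↥Λ ↥Λ ℝ) ⟨u, h.1⟩ ⟨w, h.2⟩ else 0)) -
              cumulantSum (gaussianFieldOfKernel fun u w => if h : u ∈ Λ ∧ w ∈ Λ then
                  ((Matrix.reindex e' e'
                    (Matrix.of fun p q : σ × TrIdx N =>
                        trReForm (trBasis N p.2) (((CsDeltaCPY x (lettersYOfRecordV4 N θ Mstar (resYOfC2 N θ Mstar 𝔠) x)
            (sectEYOfRecordV6 N θ Mstar (sectEYWithDt2 N θ Mstar (resYOfC2 N θ Mstar 𝔠) 𝔡₂ 𝔢₀) x) U).restrictScalars ℝ)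
                          (Pi.single (ι q.1) (trBasis N q.2)) (ι p.1))))⁻¹ :
                      Matrix ↥Λ ↥Λ ℝ) ⟨u, h.1⟩ ⟨w, h.2⟩ else 0)
                (hamiltonian s D ϰ 𝔞 J) t| ≤ C * η ^ κ' * I.card := by
  obtain ⟨M₄, δ, a₀, hM₄, hδ, ha₀, b₁, hb₁⟩ :=
    eq324_CsDeltaCPY_opsYOfRecordV8E_trBasis_of_stmt3132Printed_R_of_adjCurrent_onΛ_on_unit N θ hD Mstar 𝔠 𝔡₂ 𝔢₀ 𝔢 𝔴 𝔈 R₁ R₂ hR h26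
      (r₂ := r₂) hγ₀ ha hj₁ hC₂ hsmall t D hϰ hp₀ hσ hc hκ hκσ
  refine ⟨M₄, δ, a₀, hM₄, hδ, ha₀, b₁, fun b₀ hb₀ => ?_⟩
  obtain ⟨C, hC, hE⟩ := hb₁ b₀ hb₀
  refine ⟨C, hC, ?_⟩
  intro η hη hηle x _ hMx α₀ hα₀ hMa U h1 h2 hP hCr hDr σ _ _ _ ι hι hιT S hHJ hDsupp hDloc hDsz h2153
  have hU : ∀ μ z, U μ z ∈ specialUnitaryUnits (Fin N) := mem_of_reg335R (R₂ := R₂) hR x (U := U) h1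
  exact hE η hη hηle x hMx α₀ hα₀ hMa U h1 h2 hP hCr hDr ι hι hιT S hHJ hDsupp hDloc hDsz fun Φ hΦ =>
    coercive_CsDeltaCPY_of_ineq2153_of_units x (avYOfRecord x) (lettersYOfRecordV4 N θ Mstar (resYOfC2 N θ Mstar 𝔠) x)
      (sectEYWithDt2 N θ Mstar (resYOfC2 N θ Mstar 𝔠) 𝔡₂ 𝔢₀ x)
      (fun b => B7Prop2Explicit.mem_unitaryUnits.mp (specialUnitaryUnits_le_unitaryUnits (avYOfRecord_mem x hU b)))
      (fun c' => (isUnit_KY_KTY_avYOfRecord_of_plaqSmall N θ Mstar x specialUnitaryUnits_le_unitaryUnits hU c' ha (hP c') hsmall).1)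
      (fun c' => (isUnit_KY_KTY_avYOfRecord_of_plaqSmall N θ Mstar x specialUnitaryUnits_le_unitaryUnits hU c' ha (hP c') hsmall).2)
      hγ₀.le h2153 Φ fun q hq => hΦ q fun hq' => hq (by obtain ⟨s, rfl⟩ := hq'; exact hιT s)

end DoorOfRecord

end Literature.MathematicalPhysics.QuantumFieldTheory.Balaban1983to89.B1Eq324BenfattoClassSectEMemberPrecisionDoorIneq2153AtOne
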